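import Mathlib.Probability.Distributions.Uniform
import Literature.Probability.RandomGraphs.LowDegree
import Literature.Computability.Complexity.AOWRefutation
import Literature.Computability.Complexity.Classes
import HarnessLib

/-!
# Barrier catalogue `PneNP`: counterexamples to the low-degree conjecture (Holmgren–Wein 2021) —
the symmetry hypothesis cannot be dropped from "low-degree hardness ⇒ polynomial-time hardness"

D-0021 barrier entry for the summit `PneNP`, bearing on route PneNP/PlantedClique
(`Summits/PneNP/PneNP/Theses/PlantedClique.lean`), whose crux #2 is the transfer principle
"low-degree hard (`‖Lₙ^{≤D}‖ = O(1)`, tree: `Literature.Probability.RandomGraphs.LowDegree.lowDegreeLRSq`) ⇒ polynomial-time hard"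
for `Sₙ`-symmetric planted problems in `G(n,1/2)` and whose kill criterion is a Holmgren–Wein-type
counterexample INSIDE the symmetric class: the transfer principle is FALSE once the symmetry
assumption is dropped (Boolean alphabet), and false as literally conjectured by Hopkins over
`Ω = ℝ`.

**The printed results** (J. Holmgren, A. S. Wein, *Counterexamples to the low-degree
conjecture*, ITCS 2021 = arXiv:2004.08454; held, `lit read arxiv:2004.08454`, 11 PDF pages):

* Conjecture 1 (Hopkins 2018; PDF p. 5): `Ω` a finite set or `ℝ`, `k ≥ 1`, `N = (n choose k)`,
  `ν` a product distribution on `Ω^N`, `μ` another distribution on `Ω^N`, `Sₙ`-invariant and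
  `(log n)^{1+Ω(1)}`-wise almost independent with respect to `ν`. "Then no polynomial-time
  computable test distinguishes `T_δ μ` and `ν` with probability `1 - o(1)`, for any `δ > 0`.
  Formally, for all `δ > 0` and every polynomial-time computable `t : Ω^N → {0,1}` there exists
  `δ' > 0` such that for every large enough `n`,
  `½ P_{x∼ν}(t(x) = 0) + ½ P_{x∼T_δ μ}(t(x) = 1) ≤ 1 - δ'`."
* Def. 1 (PDF p. 5): "`μ` on `Ω^N` is `D`-wise independent with respect to `ν` if for any
  `S ⊆ [N]` with `|S| ≤ D` we have equality of the marginal distributions `μ|_S = ν|_S`";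
  `D`-wise almost independence "is implied by exact `D`-wise independence".
* Def. 2 (PDF p. 5), the noise operator: to sample `z ∼ T_δ μ`, sample `x ∼ μ`, `y ∼ ν`
  independently and independently for each `i` let `zᵢ = xᵢ` with probability `1 - δ`, `zᵢ = yᵢ`
  with probability `δ`.
* **Thm. 2** (PDF p. 6): "The following holds for infinitely many `n`. Let `Ω = {0,1}` and
  `ν = Unif({0,1}ⁿ)`. There exists a distribution `μ` on `Ωⁿ` such that `μ` is `Ω(n)`-wise
  independent with respect to `ν`, and for some constant `δ > 0` there exists a polynomial-time
  computable test distinguishing `T_δ μ` and `ν` with probability `1 - o(1)`." — "in the case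
  where `Ω` is a finite set, the `Sₙ`-invariance assumption cannot be dropped from Conjecture 1";
  Thm. 1 (PDF p. 6): over `Ω = ℝ`, `ν = Unif([0,1]ⁿ)`, even an `Sₙ`-invariant `Ω(n)`-wise
  independent `μ` is distinguishable — Conjecture 1 itself is refuted for real-valued data,
  exploiting the resampling noise `T_δ` (Rem. 2 proposes Ornstein–Uhlenbeck noise instead).
  "Note that we refute an even weaker statement than Conjecture 1 because our counterexample has
  exact `Ω(n)`-wise independence" (PDF p. 6).
* Proof of Thm. 2 (§5.2, PDF p. 9, with Prop. 1 and Prop. 3, PDF p. 7): `μ` = uniform over the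
  codewords of a binary linear code of length `n = 42·8^{i+1}` with dual distance `≥ ζn`,
  `ζ ≥ 1/30`, efficiently decodable from `ζn/2` errors (Guruswami); dual distance `d` makes the
  uniform distribution on codewords `(d-1)`-wise independent (Prop. 1); `δ = min{1/(16e), ζ/8}`;
  the test decodes the sample and accepts iff it finds a codeword at Hamming distance `≤ 2δn`;
  under `T_δ μ` decoding succeeds w.h.p., under `ν` no codeword is that close w.h.p. (Lemma 1).
* Abstract (PDF p. 2): "These results do not undermine the low-degree framework for
  computational lower bounds, but rather aim to better understand what class of problems it is
  applicable to."

**What this file adds.** Over the Boolean cube `{0,1}^ι` (`ι` a finite index type, as in the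
tree's `Literature/Probability/RandomGraphs/LowDegree.lean`; `ν` uniform; marginals by Mathlib's
`Finset.restrict`): `IsDWiseIndependent` (Def. 1), the noise operator `noiseOp δ` (Def. 2; resampling set from the
tree's product law `Literature.Computability.Complexity.subsetPMF`), and the BRIDGE to the route's vocabulary, PROVED:
`IsDWiseIndependent D μ → lowDegreeLRSq μ D = 1` (`IsDWiseIndependent.lowDegreeLRSq_eq_one`: exact
independence kills every Walsh coefficient of degree `1 … D`, so the squared low-degree
likelihood ratio takes its minimum value `1` — the strongest form of the crux's hypothesis
"`‖Lₙ^{≤D}‖ = O(1)`"); at `ι = Fin n`: the success probability `testSuccess` of the test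
"`x ↦ [x ∈ L]`" given by a language `L` (polynomial time = the tree's `Literature.Computability.Complexity.Classes.P`), the
technique class as an explicit statement `LowDegreeTransfer D` (the conclusion of Conjecture 1
for ALL `D(n)`-wise independent Boolean `μ`, symmetry dropped — the statement Thm. 2 refutes),
the barrier fact `LowDegreeCounterexamples` (Thm. 2, named fact), and PROVED:
`isDWiseIndependent_uniform`, `LowDegreeCounterexamples.not_lowDegreeTransfer` (for every `D`
eventually below `⌊c n⌋`, in particular for every polylogarithmic `D`,
`not_lowDegreeTransfer_of_isLittleO`).

**Later literature (barrier audit, 2026-08-16): what the `Sₙ`-symmetry hypothesis does and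
does not save.** Thm. 2 drops symmetry; the state of the SYMMETRIC Boolean conjecture is now
settled in print, in both directions, and the entry's `evasions_known`/`scope_caveats` below are
worded accordingly. (i) `k = 1` (strings, `Sₙ` permuting coordinates — the format of this file's
`LowDegreeTransfer`): the symmetric conjecture is TRUE, even statistically — for `ν = Ber(p)ⁿ`,
`μ` `Sₙ`-symmetric with degree-`D` `χ²`-advantage `≤ δ`, `D ≥ (C_p/ε) log n`, one has
`TV(ν, T_ε μ) ≤ O_p(δ/ε² + 1/(√n ε²))` (HsiehEtAl2026, Thm. 1.1, arXiv p. 5), so no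
computational-statistical gap survives symmetrisation at `k = 1`. (ii) `k ≥ 2` (graphs and
hypergraphs, `Sₙ` relabelling vertices — the planted-clique format): symmetry does NOT save the
transfer. BuhaiEtAl2025, Thm. 2.1 (arXiv p. 9): for every `k ≥ 2` and small `ε > 0` an
`Sₙ`-symmetric `Pₙ` on symmetric Boolean `k`-tensors with ZERO degree-`n^{1-6ε}` advantage over
the uniform `Qₙ` and an `n^{O(log^{1/(k-1)} n)}`-time distinguisher of `T_ε Pₙ` from `Qₙ` with
success `≥ 1 - exp(-n^{1-O(ε)})` (Hopkins' conjecture in its `n^{D/polylog n}`-time form is false;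
with `k`-partite symmetry the distinguisher is polynomial-time, Thm. 2.4). Mao2026, Thm. 1.2
(arXiv pp. 4–5): for every fixed `r ≥ 3`, permutation-invariant `Pₙ` on graphs with EVERY
marginal on `≤ ⌊c_r (log₂ n)^{r-1}⌋` edges exactly uniform and a DETERMINISTIC POLYNOMIAL-TIME
rank test strongly distinguishing `T_{ε_r} Pₙ` from `Qₙ = G(n,1/2)` — the polynomial-time
conjecture (Hopkins 2018, Conj. 2.2.4) is false for graphs; caveat (arXiv p. 5): "The planted
distribution is chosen nonconstructively, and finding a uniformly samplable example remains open"
(a randomized sampler with `O(n (log n)^r)` bits of advice exists). Neither (ii)-result is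
vendored here as a fact (candidate `LowDegreeCounterexamplesSymmetric`, over a graph-valued
technique class); this entry's fact and technique class are unchanged.

## Sources

* [HolmgrenWein2021] arXiv:2004.08454: abstract (PDF p. 2), §1 (PDF pp. 3–4), §2 (Conj. 1,
  Defs. 1–2, PDF p. 5), §3 (Thms. 1–2, Rems. 1–2, PDF p. 6), §4 (Props. 1–3, PDF p. 7), §5
  (Lemmas 1–2, proofs, PDF pp. 8–9) — held.
* [KuniskyWeinBandeira2019], [Hopkins2018] — tree keys, through `LowDegree.lean` (`‖L^{≤D}‖`).
* [BuhaiEtAl2025] R.-D. Buhai, J.-T. Hsieh, A. Jain, P. K. Kothari, *The quasi-polynomial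
  low-degree conjecture is false*, FOCS 2025 = arXiv:2505.17360: Conj. 1.2 and Thm. 1.3 (arXiv
  pp. 4–5), Thm. 2.1, Rem. 2.3, Thm. 2.4 (arXiv p. 9) — held.
* [Mao2026] S. Mao, *The polynomial-time low-degree conjecture is false*, arXiv:2607.20318
  (22 Jul 2026; preprint): Conj. 1.1, Thm. 1.2 (arXiv pp. 4–5) — held.
* [HsiehEtAl2026] J.-T. Hsieh, D. M. Kane, P. K. Kothari, J. Li, S. Mohanty, S. Tiegel, *Rigorous
  implications of the low-degree heuristic*, STOC 2026 = arXiv:2601.05850: Thm. 1.1 (arXiv p. 5)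
  — held.
* [SaptharishiShpilkaVolk2016] R. Saptharishi, A. Shpilka, B. L. Volk, *Efficiently decoding
  Reed–Muller codes from random errors*, STOC 2016 = arXiv:1503.09092: Thm. 1 (arXiv p. 4) — held;
  used only in the noise-rate caveat (audit sketch, see `LowDegreeCounterexamplesNoise.lean`).
-/

noncomputable section

namespace Literature.Barriers.PneNP

open scoped ENNReal
open Filter Finset Literature.Computability.Complexity Literature.Computability.Complexity.Classes Literature.Probability.RandomGraphs.LowDegree

variable {ι : Type} [Fintype ι] [DecidableEq ι]

/-! ### `D`-wise independence (Def. 1) on the cube `{0,1}^ι` -/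

/-- **`D`-wise independence with respect to the uniform distribution** (Def. 1 with `ν` uniform
on `{0,1}^ι`): for every `S` with `|S| ≤ D` the marginal `μ|_S` is uniform on `{0,1}^S` (marginal map = Mathlib's `Finset.restrict`).
[cite: HolmgrenWein2021, Def. 1 (PDF p. 5)] -/
def IsDWiseIndependent (D : ℕ) (μ : PMF (ι → Bool)) : Prop :=
  ∀ S : Finset ι, S.card ≤ D → μ.map S.restrict = PMF.uniformOfFintype (S → Bool)

omit [Fintype ι] in
/-- More independence gives less: `D' ≤ D → D-wise ⇒ D'-wise`. [folklore] -/
theorem IsDWiseIndependent.of_le {D D' : ℕ} {μ : PMF (ι → Bool)} (h : IsDWiseIndependent D μ)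
    (hle : D' ≤ D) : IsDWiseIndependent D' μ :=
  fun S hS => h S (hS.trans hle)

/-- The number of assignments with a prescribed restriction to `S` is `|{0,1}^ι| / |{0,1}^S|`:
`|{0,1}^ι| = |{0,1}^S| · |fibre|` (split an assignment into its parts on `S` and off `S`).
[folklore] -/
theorem card_mul_card_fibre_restrict (S : Finset ι) (y : S → Bool) :
    Fintype.card (S → Bool) * (univ.filter fun x : ι → Bool => S.restrict x = y).card =
      Fintype.card (ι → Bool) := by
  classical
  let e := Equiv.piEquivPiSubtypeProd (fun i : ι => i ∈ S) (fun _ => Bool)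
  have hfib : (univ.filter fun x : ι → Bool => S.restrict x = y).card =
      Fintype.card ({i : ι // ¬ i ∈ S} → Bool) := by
    rw [← Fintype.card_coe]
    refine Fintype.card_congr ?_
    refine
      { toFun := fun x => (e x.1).2
        invFun := fun z => ⟨e.symm (y, z), ?_⟩
        left_inv := ?_
        right_inv := ?_ }
    · simp only [mem_filter, mem_univ, true_and]
      funext i
      change (e.symm (y, z)) i = y i
      simp [e, Equiv.piEquivPiSubtypeProd, i.2]
    · rintro ⟨x, hx⟩
      simp only [mem_filter, mem_univ, true_and] at hx
      apply Subtype.ext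
      change e.symm (y, (e x).2) = x
      have : y = (e x).1 := by
        funext i
        rw [← hx]
        simp [e, Equiv.piEquivPiSubtypeProd, Finset.restrict]
      rw [this, Prod.mk.eta, Equiv.symm_apply_apply]
    · intro z
      change (e (e.symm (y, z))).2 = z
      rw [Equiv.apply_symm_apply]
  rw [hfib, ← Fintype.card_prod]
  exact (Fintype.card_congr e).symm

/-- **The uniform distribution is `D`-wise independent for every `D`** (its marginals are
uniform). Used to extend a family of distributions given for infinitely many `n` to all `n`.
[folklore] -/
theorem isDWiseIndependent_uniform (D : ℕ) :
    IsDWiseIndependent D (PMF.uniformOfFintype (ι → Bool)) := by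
  classical
  intro S _
  ext y
  rw [PMF.map_apply, PMF.uniformOfFintype_apply, tsum_fintype]
  simp_rw [PMF.uniformOfFintype_apply]
  rw [← Finset.sum_filter, sum_const, nsmul_eq_mul]
  have hcard := card_mul_card_fibre_restrict S y
  have hfilter : (univ.filter fun x : ι → Bool => y = S.restrict x) =
      univ.filter fun x : ι → Bool => S.restrict x = y := by
    ext x; simp [eq_comm]
  rw [hfilter]
  set A : ℕ := Fintype.card (S → Bool) with hA
  set B : ℕ := (univ.filter fun x : ι → Bool => S.restrict x = y).card with hB
  have hA0 : (A : ℝ≥0∞) ≠ 0 := by exact_mod_cast Fintype.card_ne_zero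
  have hB0 : (B : ℝ≥0∞) ≠ 0 := by
    have : 0 < B := card_pos.2 ⟨fun i => if h : i ∈ S then y ⟨i, h⟩ else false, by
      simp only [mem_filter, mem_univ, true_and]
      funext i; simp [Finset.restrict, i.2]⟩
    exact_mod_cast this.ne'
  rw [← hcard, Nat.cast_mul, ENNReal.mul_inv (Or.inl hA0) (Or.inl (ENNReal.natCast_ne_top A)),
    mul_comm (B : ℝ≥0∞), mul_assoc, ENNReal.inv_mul_cancel hB0 (ENNReal.natCast_ne_top B), mul_one]

/-! ### Bridge to the low-degree likelihood ratio: exact independence gives `‖L^{≤D}‖² = 1` -/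

/-- Pushing a finite expectation forward along a map: `Σ_x μ(x) f(r x) = Σ_z (r_* μ)(z) f(z)`.
[folklore] -/
theorem sum_toReal_mul_comp {α β : Type} [Fintype α] [Fintype β] [DecidableEq β] (μ : PMF α)
    (r : α → β) (f : β → ℝ) :
    ∑ x, (μ x).toReal * f (r x) = ∑ z, (μ.map r z).toReal * f z := by
  have hmap : ∀ z, (μ.map r z).toReal = ∑ x, if z = r x then (μ x).toReal else 0 := by
    intro z
    rw [PMF.map_apply, tsum_fintype, ENNReal.toReal_sum fun x _ => ?_]
    · refine sum_congr rfl fun x _ => ?_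
      split_ifs <;> simp
    · split_ifs <;> simp [PMF.apply_ne_top]
  simp_rw [hmap, sum_mul]
  rw [sum_comm]
  refine sum_congr rfl fun x _ => ?_
  simp_rw [ite_mul, zero_mul]
  rw [Finset.sum_ite_eq' univ (r x)]
  simp

omit [Fintype ι] [DecidableEq ι] in
/-- A Walsh character of `T` factors through the restriction to `T`. [folklore] -/
theorem walsh_eq_comp_restrict (T : Finset ι) (x : ι → Bool) :
    walsh T x = ∏ i : T, sgn (T.restrict x i) := by
  rw [walsh, ← prod_coe_sort]
  rfl

omit [Fintype ι] in
/-- Under the uniform distribution on `{0,1}^S`, a nonempty product of signs averages to `0`: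
`Σ_z ∏_{i ∈ S} (-1)^{zᵢ} = ∏_{i ∈ S} (1 + (-1)) = 0`. [folklore] -/
theorem sum_prod_sgn_eq_zero (S : Finset ι) (hS : S.Nonempty) :
    ∑ z : S → Bool, ∏ i : S, sgn (z i) = 0 := by
  rw [← Fintype.piFinset_univ, ← Finset.prod_univ_sum]
  obtain ⟨i, hi⟩ := hS
  exact prod_eq_zero (mem_univ ⟨i, hi⟩) (by simp [sgn])

/-- **Exact independence kills the Walsh coefficients**: if `μ` is `D`-wise independent then
`E_μ[χ_T] = 0` for every nonempty `T` with `|T| ≤ D` (the `T`-marginal is uniform).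
[cite: HolmgrenWein2021, §2 (PDF p. 5: "implied by exact D-wise independence")] -/
theorem IsDWiseIndependent.charMean_eq_zero {D : ℕ} {μ : PMF (ι → Bool)}
    (h : IsDWiseIndependent D μ) {T : Finset ι} (hT : T.Nonempty) (hTD : T.card ≤ D) :
    charMean μ T = 0 := by
  classical
  unfold charMean
  simp_rw [walsh_eq_comp_restrict T]
  rw [sum_toReal_mul_comp μ T.restrict (fun z => ∏ i : T, sgn (z i)), h T hTD]
  simp_rw [PMF.uniformOfFintype_apply]
  rw [← mul_sum, sum_prod_sgn_eq_zero T hT, mul_zero]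

/-- **Bridge to route PneNP/PlantedClique's crux #2**: a `D`-wise independent `μ` has squared
low-degree likelihood ratio `‖L^{≤D}‖² = 1` (its minimum, `one_le_lowDegreeLRSq`) against the
uniform null — only the constant character survives. So `IsDWiseIndependent (D n) (μ n)` for all
`n` is the strongest instance of the crux's hypothesis "`‖Lₙ^{≤D}‖ = O(1)`".
[cite: HolmgrenWein2021, §2 (PDF p. 5) and Thm. 2 ("Ω(n)-wise independent")] -/
theorem IsDWiseIndependent.lowDegreeLRSq_eq_one {D : ℕ} {μ : PMF (ι → Bool)}
    (h : IsDWiseIndependent D μ) : lowDegreeLRSq μ D = 1 := by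
  classical
  unfold lowDegreeLRSq
  rw [← sum_erase_add _ _ (show (∅ : Finset ι) ∈ degLE ι D by simp [degLE])]
  rw [sum_eq_zero fun T hT => ?_, zero_add, charMean_empty, one_pow]
  simp only [mem_erase, degLE, mem_filter, mem_univ, true_and] at hT
  rw [h.charMean_eq_zero (nonempty_iff_ne_empty.2 hT.1) hT.2, zero_pow two_ne_zero]

/-! ### The noise operator `T_δ` (Def. 2) -/

/-- **The noise operator `T_δ`** for `ν` uniform on `{0,1}^ι`: sample `x ∼ μ`, a resampling set
`T` (each coordinate independently with probability `δ`; the tree's product law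
`Literature.Computability.Complexity.subsetPMF`, `δ` clamped to `[0,1]`) and `y ∼ ν`, and output `z` with `zᵢ = yᵢ` for
`i ∈ T`, `zᵢ = xᵢ` otherwise. [cite: HolmgrenWein2021, Def. 2 (PDF p. 5)] -/
def noiseOp (δ : ℝ) (μ : PMF (ι → Bool)) : PMF (ι → Bool) :=
  μ.bind fun x => (subsetPMF ι δ).bind fun T =>
    (PMF.uniformOfFintype (ι → Bool)).map fun y i => if i ∈ T then y i else x i

/-! ### Tests and the transfer principle (Conjecture 1, Boolean, symmetry dropped), `ι = Fin n` -/

/-- The success probability of the test "accept iff the sample, read as a string, lies in `L`"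
at distinguishing `T_δ μ` from `ν = Unif({0,1}ⁿ)`:
`½ P_{x∼ν}(t(x) = 0) + ½ P_{x∼T_δ μ}(t(x) = 1)` (Conjecture 1's quantity).
[cite: HolmgrenWein2021, Conj. 1 (PDF p. 5)] -/
def testSuccess {n : ℕ} (L : Language Bool) (δ : ℝ) (μ : PMF (Fin n → Bool)) : ℝ :=
  (1 / 2) * ((PMF.uniformOfFintype (Fin n → Bool)).toOuterMeasure
      {x | List.ofFn x ∉ L}).toReal +
    (1 / 2) * ((noiseOp δ μ).toOuterMeasure {x | List.ofFn x ∈ L}).toReal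

/-- **Technique class: the low-degree transfer principle without symmetry** (the conclusion of
Hopkins' Conjecture 1 in the Boolean case `Ω = {0,1}`, `k = 1`, `ν` uniform, demanded of EVERY
sequence `μₙ` that is `D(n)`-wise independent — exact independence, which implies the
conjecture's almost-independence hypothesis and forces `‖Lₙ^{≤D(n)}‖² = 1`
(`IsDWiseIndependent.lowDegreeLRSq_eq_one`), so this is the "even weaker statement" that
Holmgren–Wein refute once `Sₙ`-invariance is dropped): for every `δ > 0` and every
polynomial-time test (a language `L ∈ P`) there is `δ' > 0` such that for all large `n` the
success probability is `≤ 1 - δ'`. A route that infers polynomial-time hardness from low-degree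
hardness for non-symmetric Boolean planted problems asserts an instance of this.
[cite: HolmgrenWein2021, Conj. 1 (PDF p. 5) and Thm. 2 (PDF p. 6)] -/
def LowDegreeTransfer (D : ℕ → ℕ) : Prop :=
  ∀ μ : ∀ n : ℕ, PMF (Fin n → Bool), (∀ n, IsDWiseIndependent (D n) (μ n)) →
    ∀ δ : ℝ, 0 < δ → ∀ L ∈ P,
      ∃ δ' : ℝ, 0 < δ' ∧ ∀ᶠ n : ℕ in atTop, testSuccess L δ (μ n) ≤ 1 - δ'

/-- The transfer principle for a larger `D` is a weaker statement (it constrains fewer `μ`):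
`D ≤ D'` pointwise gives `LowDegreeTransfer D → LowDegreeTransfer D'` (`Monotone` in Mathlib's
order on `Prop`-valued functions). [folklore] -/
theorem LowDegreeTransfer.mono {D D' : ℕ → ℕ} (h : LowDegreeTransfer D) (hle : ∀ n, D n ≤ D' n) :
    LowDegreeTransfer D' :=
  fun μ hμ => h μ fun n => (hμ n).of_le (hle n)

/-! ### The barrier fact: Theorem 2 -/

/-- **Holmgren–Wein 2021, Thm. 2: "The following holds for infinitely many `n`. Let `Ω = {0,1}`
and `ν = Unif({0,1}ⁿ)`. There exists a distribution `μ` on `Ωⁿ` such that `μ` is `Ω(n)`-wise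
independent with respect to `ν`, and for some constant `δ > 0` there exists a polynomial-time
computable test distinguishing `T_δ μ` and `ν` with probability `1 - o(1)`."** Vendored with the
constants uniform in `n`, as the proof provides (one binary code family with dual distance
`≥ ζn`, one decoder, `δ = min{1/(16e), ζ/8}`): there are `c > 0`, `δ > 0`, a language `L ∈ P`
(the test), a vanishing `ε`, and for infinitely many `n` a `⌊c n⌋`-wise independent `μₙ` with
success probability `≥ 1 - εₙ`. Named fact (the coding-theoretic construction — Guruswami's
codes, Prop. 3 — is not formalised).

BARRIER
technique_class: low-degree-method, low-degree-likelihood-ratio, low-degree-conjecture, low-degree-to-polynomial-time-transfer, k-wise-independence, planted-versus-null-testing, statistical-computational-gaps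
blocks: the inference "low-degree statistics fail (here even: `μ` is `Ω(n)`-wise EXACTLY independent of the null, so `‖Lₙ^{≤D}‖² = 1` for `D = Ω(n)`, `IsDWiseIndependent.lowDegreeLRSq_eq_one`) ⇒ no polynomial-time test succeeds" for Boolean planted-versus-null problems WITHOUT the `Sₙ`-symmetry hypothesis — `LowDegreeTransfer D` is false for every `D` eventually below `⌊c n⌋`, in particular for every `D(n) = (log n)^{O(1)}` and every `D = o(n)` (proved: `LowDegreeCounterexamples.not_lowDegreeTransfer`, `not_lowDegreeTransfer_of_isLittleO`); this is the transfer principle of route PneNP/PlantedClique's crux #2 with its symmetry hypothesis removed, i.e. exactly the shape of that route's kill criterion ("a Holmgren–Wein-type counterexample inside the class") [cite: HolmgrenWein2021, Thm. 2 (PDF p. 6)]; over real-valued data `Ω = ℝ` with the resampling noise `T_δ`, Hopkins' Conjecture 1 fails even WITH `Sₙ`-invariance (Thm. 1) [cite: HolmgrenWein2021, Thm. 1 and Rem. 2 (PDF p. 6)].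
because: take `μ` uniform on the codewords of a binary linear code with dual distance `≥ ζn` and an efficient decoder from `ζn/2` errors (Prop. 3): dual distance `d` gives `(d-1)`-wise independence (Prop. 1), so low-degree statistics see nothing, while the test "decode and accept iff a codeword lies within Hamming distance `2δn`" succeeds — under `T_δ μ` at most `2δn ≤ ζn/4` coordinates change w.h.p. so decoding recovers the codeword, under `ν` no codeword is within `2δn` w.h.p. since radius-`4δn` Hamming balls around codewords are disjoint (Lemma 1, `δ ≤ 1/(16e)`) [cite: HolmgrenWein2021, §5.2 (PDF p. 9), Prop. 1 and Prop. 3 (PDF p. 7), Lemma 1 (PDF p. 8)]; algebraic structure (exactly solvable linear equations) defeats low-degree predictions in general unless noise destroys it [cite: HolmgrenWein2021, §1 (PDF p. 3)].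
evasions_known: in print 2021: keep the hypotheses the counterexamples violate — `Sₙ`-invariance (finite `Ω`: "we give an example illustrating that (even after the above modification), the symmetry assumption in the conjecture is necessary") and, over `ℝ`, a noise operator touching every coordinate (Ornstein–Uhlenbeck) instead of resampling a few: "a simple way to modify the conjecture to rule out our counterexample" [cite: HolmgrenWein2021, abstract (PDF p. 2) and Rem. 2 (PDF p. 6)], "These results do not undermine the low-degree framework ... but rather aim to better understand what class of problems it is applicable to" [cite: HolmgrenWein2021, abstract (PDF p. 2) and §1 (PDF pp. 3–4)]. State of that evasion in 2026 (audit): for STRINGS (`k = 1`, `Sₙ` permuting coordinates) restoring symmetry over-succeeds — the symmetric conjecture is a theorem in total variation, `TV(ν, T_ε μ) → 0` whenever the degree-`D` advantage is bounded with `D ≥ (C/ε) log n` [cite: HsiehEtAl2026, Thm. 1.1 (arXiv p. 5)], so a symmetric string problem with low-degree hardness has NO distinguisher at all and carries no computational gap to transfer; for GRAPHS / `k`-tensors (`k ≥ 2`, `Sₙ` relabelling vertices) restoring symmetry does NOT evade: `Sₙ`-symmetric Boolean `Pₙ` with zero degree-`n^{1-6ε}` advantage yet an `n^{O(log^{1/(k-1)}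 n)}`-time noise-tolerant distinguisher [cite: BuhaiEtAl2025, Thm. 2.1 (arXiv p. 9)] (polynomial-time under `k`-partite symmetry [cite: BuhaiEtAl2025, Thm. 2.4 (arXiv p. 9)]), and permutation-invariant graph laws `Pₙ` with every marginal on `≤ ⌊c_r (log₂ n)^{r-1}⌋` edges uniform (any fixed `r ≥ 3`) yet a deterministic POLYNOMIAL-time rank test separating `T_{ε_r} Pₙ` from `G(n,1/2)` [cite: Mao2026, Thm. 1.2 (arXiv pp. 4–5)] — Hopkins' polynomial-time Conj. 2.2.4 is false for graphs (preprint, 22 Jul 2026). What still evades every printed counterexample: (a) problem-SPECIFIC low-degree predictions (planted clique, community detection) — none of the constructions is a natural planted problem; (b) an extra hypothesis the constructions lack — [Mao2026]'s `Pₙ` is non-constructive ("finding a uniformly samplable example remains open", arXiv p. 5) while [BuhaiEtAl2025]'s samplable `Pₙ` has only a quasi-polynomial distinguisher, so "uniformly poly-time samplable `Sₙ`-symmetric `Pₙ` + degree-`(log n)^{1+c}` hardness ⇒ no poly-time noise-tolerant test" is not refuted in print (and not supported either: "a valid general conjecture must impose an additional condition" [cite: Mao2026, abstract (arXiv p. 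1)]).
scope_caveats: Thm. 2 refutes only the symmetry-free (Thm. 2) and the real-valued resampling-noise (Thm. 1) versions and by itself says nothing about `Sₙ`-invariant problems over finite alphabets such as planted clique in `G(n,1/2)` [cite: HolmgrenWein2021, §3 (PDF p. 6)]; but the GENERIC symmetric transfer principle for graph-valued problems with null `G(n,1/2)` is refuted in later print ([cite: BuhaiEtAl2025, Thm. 2.1 (arXiv p. 9)] quasi-polynomial, [cite: Mao2026, Thm. 1.2 (arXiv pp. 4–5)] polynomial-time; see `evasions_known`), so route PneNP/PlantedClique's crux #2 survives these only because it is filed for the planted-clique FAMILY alone (`PlantedcliqueLowDegreePrediction`; tree `Literature.Probability.RandomGraphs.PlantedClique.hopkins_lowDegree_bounded`, `Literature.Probability.RandomGraphs.LowDegree.lowDegreeLRSq`) — a crux asserting transfer for ALL `Sₙ`-invariant graph laws with polylog-wise-uniform marginals is refuted in print (not yet vendored as a fact here); the vendored fact uses exact `⌊cn⌋`-wise independence (stronger than the conjecture's almost-independence hypothesis, as in print), the tree's `P` for "polynomial-time computable test" (tests read the sample as the string `List.ofFn x`), `ν` uniform and `k = 1` only; the low-degree side is connected to the route's `‖L^{≤D}‖`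 only through the proved bridge `IsDWiseIndependent.lowDegreeLRSq_eq_one` (exact independence ⇒ `‖L^{≤D}‖² = 1`); the conjecture's general "D-wise ALMOST independence" is not formalised [cite: HolmgrenWein2021, §2 (PDF p. 5: "implied by exact D-wise independence")]; the coding-theoretic leaf below the fact (`DecodableDualDistanceCodes`, file `LowDegreeCounterexamplesCodes.lean`) was audited 2026-08-16 and confirmed against Shpilka 2009, Thm. 4 and App. A (the uniform polynomial-time decoder is explicit there); noise rate (audit of the noise step, 2026-08-17; details in the module docstring of `LowDegreeCounterexamplesNoise.lean`): the refutation is proved at ONE small resampling rate (`δ = 1/512` at test radius `⌊n/128⌋` in `LowDegreeCounterexamplesProofs.lean`; `δ = min{1/(16e), ζ/8}` in print [cite: HolmgrenWein2021, §5.2 (LIPIcs p. 75:8)]) and therefore at every smaller rate (re-noising), which suffices because `LowDegreeTransfer` and Conjecture 1 demand the conclusion for EVERY `δ > 0`; the later Boolean counterexamples are likewise proved at one small rate ("small enough `ε`" [cite: BuhaiEtAl2025, Thm. 2.1 (arXiv p. 9)]; `ε_r` "so small that `aλ < 1/2`" [cite: Mao2026, Lemma 3.5 (arXiv p. 25)]),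 so a per-rate transfer principle at a FIXED LARGE rate (heavy noise, beyond every unique-decoding radius) is not refuted by any printed statement — for non-symmetric strings it is nevertheless expected to fail at every rate `< 1` (inner low-rate Reed–Muller codes are decodable in polynomial time from a `p`-fraction of random errors for every `p < 1/2` [cite: SaptharishiShpilkaVolk2016, Thm. 1 (arXiv p. 4)], audit sketch in the noise file, reaching `2^{Θ(√log n)}`-wise rather than `Ω(n)`-wise independence), while heavy noise for the `Sₙ`-symmetric graph counterexamples is open.
status: established [cite: HolmgrenWein2021, Thm. 2] -/
def LowDegreeCounterexamples : Prop :=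
  ∃ (c δ : ℝ) (L : Language Bool) (ε : ℕ → ℝ),
    0 < c ∧ 0 < δ ∧ L ∈ P ∧ Tendsto ε atTop (nhds 0) ∧
    ∃ᶠ n : ℕ in atTop, ∃ μ : PMF (Fin n → Bool),
      IsDWiseIndependent ⌊c * (n : ℝ)⌋₊ μ ∧ 1 - ε n ≤ testSuccess L δ μ

/-! ### The refutation (proved from the fact) -/

/-- **Thm. 2 refutes the symmetry-free transfer principle below linear independence**: from the
fact, `¬ LowDegreeTransfer D` for every `D` with `D n ≤ ⌊c n⌋` for all LARGE `n` (the fact's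
constant `c > 0`). Proof: extend the printed family `μₙ` (given for infinitely many `n`) by the
uniform distribution at every other `n` and at the finitely many `n` where `D n > ⌊c n⌋`
(`isDWiseIndependent_uniform`); the transfer principle would cap the success probability at
`1 - δ'` for all large `n`, but it is `≥ 1 - εₙ → 1` infinitely often.
[cite: HolmgrenWein2021, Thm. 2 (PDF p. 6: "the Sₙ-invariance assumption cannot be dropped")] -/
theorem LowDegreeCounterexamples.not_lowDegreeTransfer (h : LowDegreeCounterexamples) :
    ∃ c : ℝ, 0 < c ∧ ∀ D : ℕ → ℕ, (∀ᶠ n : ℕ in atTop, D n ≤ ⌊c * (n : ℝ)⌋₊) →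
      ¬ LowDegreeTransfer D := by
  classical
  obtain ⟨c, δ, L, ε, hc, hδ0, hL, hε, hfreq⟩ := h
  refine ⟨c, hc, fun D hD htrans => ?_⟩
  -- good lengths: the budget fits and a printed `μₙ` exists
  let good : ℕ → Prop := fun n => D n ≤ ⌊c * (n : ℝ)⌋₊ ∧
    ∃ μ : PMF (Fin n → Bool), IsDWiseIndependent ⌊c * (n : ℝ)⌋₊ μ ∧ 1 - ε n ≤ testSuccess L δ μ
  -- the extended family
  let μ : ∀ n : ℕ, PMF (Fin n → Bool) := fun n =>
    if hn : good n then hn.2.choose else PMF.uniformOfFintype (Fin n → Bool)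
  have hμind : ∀ n : ℕ, IsDWiseIndependent (D n) (μ n) := by
    intro n
    by_cases hn : good n
    · simp only [μ, dif_pos hn]
      exact hn.2.choose_spec.1.of_le hn.1
    · simp only [μ, dif_neg hn]
      exact isDWiseIndependent_uniform _
  have hμgood : ∃ᶠ n : ℕ in atTop, 1 - ε n ≤ testSuccess L δ (μ n) := by
    refine (hfreq.and_eventually hD).mono fun n hn => ?_
    have hg : good n := ⟨hn.2, hn.1⟩
    simp only [μ, dif_pos hg]
    exact hg.2.choose_spec.2
  obtain ⟨δ', hδ', hev⟩ := htrans μ hμind δ hδ0 L hL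
  have hεev : ∀ᶠ n : ℕ in atTop, ε n < δ' := (tendsto_order.1 hε).2 δ' hδ'
  obtain ⟨n, hgoodn, hbad, hεn⟩ := (hμgood.and_eventually (hev.and hεev)).exists
  linarith

/-- Hence NO sublinear `D` supports the symmetry-free transfer principle: for `D = o(n)` — e.g.
`D(n) = (log n)^{1+Ω(1)}` as in Conjecture 1, or any polylogarithm — `LowDegreeTransfer D` fails.
[cite: HolmgrenWein2021, Thm. 2 (PDF p. 6)] -/
theorem LowDegreeCounterexamples.not_lowDegreeTransfer_of_isLittleO (h : LowDegreeCounterexamples)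
    {D : ℕ → ℕ} (hD : (fun n => (D n : ℝ)) =o[atTop] fun n => (n : ℝ)) : ¬ LowDegreeTransfer D := by
  obtain ⟨c, hc, hnot⟩ := h.not_lowDegreeTransfer
  refine hnot D ?_
  -- `D n ≤ (c/2) n` eventually, and `(c/2) n ≤ ⌊c n⌋` once `c n ≥ 2`... use `(c/2) n + 1 ≤ c n`
  have h1 := hD.def (show (0 : ℝ) < c / 2 by positivity)
  have h2 : ∀ᶠ n : ℕ in atTop, (2 : ℝ) / c ≤ n :=
    tendsto_natCast_atTop_atTop.eventually (eventually_ge_atTop _)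
  filter_upwards [h1, h2] with n hn hn2
  rw [Real.norm_natCast, Real.norm_natCast] at hn
  have hcn : (2 : ℝ) ≤ c * n := by
    have := (div_le_iff₀ hc).1 hn2
    linarith
  have hle : (D n : ℝ) ≤ c * n - 1 := by linarith
  have hfloor : c * (n : ℝ) - 1 < ⌊c * (n : ℝ)⌋₊ := Nat.sub_one_lt_floor _
  exact_mod_cast (show (D n : ℝ) ≤ ⌊c * (n : ℝ)⌋₊ by linarith)

end Literature.Barriers.PneNP

end
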